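import Summits.Ventures.Crystal3D.Theorems.StickyWulffConstantCoaxialWallLawHealCap
import HarnessLib

/-!
# HEAL-CAP, cap-table row «HEXAGON ONLY»: at most FOUR off-tip further contacts, two per side (crux `CoaxialWallLaw`, stmt-Ventures-19481; lane F v8 `JunkCapBound`)

HONEST FRAMING. Venture `Summits/Ventures/Crystal3D` (cell `crystal3d-full`); an elementary cap-packing lemma `--supports` the crux `CoaxialWallLaw`
(stmt-Ventures-19481, `route-Ventures-StickyWulffConstant`), line 'Certificates' v8, analytic input `JunkCapBound` of `stub_incoherentEndPools`
('…SeamIncoherentAssembly'): the CAP TABLE row «only the basal HEXAGON of the frame dozen occupied» (19481-p2 g11: «hexagon-only: 2+2»).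
THE FACT.  A unit direction at inner product `≤ 1/2` with the six hexagon slots (`HexFree`) has axial component `|−x₀+x₁+x₂| ≥ √2` in cubic coordinates
(the hexagon of inradius `1/2` has circumradius `1/√3` — the same computation as `HealCap.axis_ge` without the lower triple), so it lies in the UPPER cap
(and is then `HealFree`: the lower-triple constraints are automatic) or in the LOWER cap (and then its negative is `HealFree`; the hexagon is centrally
symmetric).  Among five pairwise `1`-separated further contacts three lie on one side; by `healFree_three` those three are tips (upper tips `healTips`,
lower tips `−healTips`).  Hence **at most FOUR further contacts avoid the twelve tip positions** (`card_offTip_contacts_le_four_of_hexagon`); numerics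
(19481-p1 g17 calc/healcap_rows.py): four off-tip contacts exist (slack `0.028`), so the row is `4 = 2 + 2` (not `#empty − 1 = 5`).
WHAT THIS IS NOT: no statement about pools or the stub; F-C1 not moved.
-/

noncomputable section

namespace Summit.Ventures.Crystal3D.Theorems

namespace TailResidue

open Summit.Ventures.Crystal3D Finset NearIdentity
open scoped InnerProductSpace

/-- The six slots of the basal HEXAGON of the model frame (axis `(−1,1,1)`). -/
def hexSix : Finset (Fin 12) := {0, 3, 4, 7, 9, 10}

/-- A HEXAGON-FREE direction: unit, at inner product `≤ 1/2` with the six hexagon slots. -/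
def HexFree (u : EuclideanSpace ℝ (Fin 3)) : Prop :=
  ‖u‖ = 1 ∧ ∀ k ∈ hexSix, ⟪u, slotSite k⟫_ℝ ≤ 1 / 2

/-- The three hexagon constraints in cubic coordinates (`c = √2/2`). -/
theorem HexFree.constraints {u : EuclideanSpace ℝ (Fin 3)} (h : HexFree u) :
    |cubicCoords u 0 + cubicCoords u 1| ≤ Real.sqrt 2 / 2 ∧ |cubicCoords u 0 + cubicCoords u 2| ≤ Real.sqrt 2 / 2 ∧
    |cubicCoords u 1 - cubicCoords u 2| ≤ Real.sqrt 2 / 2 := by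
  have hs : 0 < Real.sqrt 2 := by positivity
  have h2 : Real.sqrt 2 * Real.sqrt 2 = 2 := Real.mul_self_sqrt (by norm_num)
  have key : ∀ k ∈ hexSix, cubicCoords u 0 * slotInt k 0 + cubicCoords u 1 * slotInt k 1 + cubicCoords u 2 * slotInt k 2 ≤ Real.sqrt 2 / 2 := by
    intro k hk
    have := h.2 k hk
    rw [inner_slotSite_right, div_le_iff₀ hs] at this
    nlinarith
  have e0 := key 0 (by decide); have e3 := key 3 (by decide); have e4 := key 4 (by decide); have e7 := key 7 (by decide)
  have e9 := key 9 (by decide); have e10 := key 10 (by decide)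
  simp only [slotInt, Matrix.cons_val_zero, Matrix.cons_val_one, Matrix.cons_val] at e0 e3 e4 e7 e9 e10
  norm_num at e0 e3 e4 e7 e9 e10
  exact ⟨abs_le.2 ⟨by linarith, by linarith⟩, abs_le.2 ⟨by linarith, by linarith⟩, abs_le.2 ⟨by linarith, by linarith⟩⟩

/-- **Axial alternative**: a hexagon-free direction has `−x₀+x₁+x₂ ≥ √2` (upper cap) or `≤ −√2` (lower cap). -/
theorem HexFree.axis_cases {u : EuclideanSpace ℝ (Fin 3)} (h : HexFree u) :
    2 * (Real.sqrt 2 / 2) ≤ -cubicCoords u 0 + cubicCoords u 1 + cubicCoords u 2 ∨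
      -cubicCoords u 0 + cubicCoords u 1 + cubicCoords u 2 ≤ -(2 * (Real.sqrt 2 / 2)) := by
  obtain ⟨h01, h02, h12⟩ := h.constraints
  have hn := cubicCoords_sq_sum h.1
  have hs : 0 < Real.sqrt 2 := by positivity
  have h2 : Real.sqrt 2 * Real.sqrt 2 = 2 := Real.mul_self_sqrt (by norm_num)
  have hcsq : (Real.sqrt 2 / 2) ^ 2 = 1 / 2 := by nlinarith
  have h02' : |-(cubicCoords u 0 + cubicCoords u 2)| ≤ Real.sqrt 2 / 2 := by rwa [abs_neg]
  have h12' : |(cubicCoords u 0 + cubicCoords u 1) + -(cubicCoords u 0 + cubicCoords u 2)| ≤ Real.sqrt 2 / 2 := by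
    have : (cubicCoords u 0 + cubicCoords u 1) + -(cubicCoords u 0 + cubicCoords u 2) = cubicCoords u 1 - cubicCoords u 2 := by ring
    rw [this]; exact h12
  have hq := HealCap.sq_form_le h01 h02' h12'
  have hid : 2 * ((cubicCoords u 0 + cubicCoords u 1) ^ 2 + (cubicCoords u 0 + cubicCoords u 1) * -(cubicCoords u 0 + cubicCoords u 2) +
      (-(cubicCoords u 0 + cubicCoords u 2)) ^ 2) =
      3 * (cubicCoords u 0 ^ 2 + cubicCoords u 1 ^ 2 + cubicCoords u 2 ^ 2) - (-cubicCoords u 0 + cubicCoords u 1 + cubicCoords u 2) ^ 2 := by ring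
  have hT2 : 2 ≤ (-cubicCoords u 0 + cubicCoords u 1 + cubicCoords u 2) ^ 2 := by nlinarith
  have hsq2 : (2 * (Real.sqrt 2 / 2)) ^ 2 = 2 := by nlinarith
  by_contra hcon
  push Not at hcon
  obtain ⟨hlt, hgt⟩ := hcon
  have hpos : 0 < 2 * (Real.sqrt 2 / 2) := by positivity
  nlinarith [mul_pos (sub_pos.2 hlt) (by linarith : 0 < -cubicCoords u 0 + cubicCoords u 1 + cubicCoords u 2 + 2 * (Real.sqrt 2 / 2))]

/-- An UPPER hexagon-free direction is heal-free (the lower-triple constraints are automatic). -/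
theorem HexFree.healFree_of_upper {u : EuclideanSpace ℝ (Fin 3)} (h : HexFree u)
    (hT : 2 * (Real.sqrt 2 / 2) ≤ -cubicCoords u 0 + cubicCoords u 1 + cubicCoords u 2) : HealFree u := by
  have hn := cubicCoords_sq_sum h.1
  have hs : 0 < Real.sqrt 2 := by positivity
  have h2 : Real.sqrt 2 * Real.sqrt 2 = 2 := Real.mul_self_sqrt (by norm_num)
  have hlt1 : 1 < Real.sqrt 2 := by nlinarith
  -- each coordinate is at most `1` in absolute value
  have b0 : cubicCoords u 0 ≤ 1 := by nlinarith [sq_nonneg (cubicCoords u 1), sq_nonneg (cubicCoords u 2), sq_nonneg (cubicCoords u 0 - 1)]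
  have b1 : cubicCoords u 1 ≤ 1 := by nlinarith [sq_nonneg (cubicCoords u 0), sq_nonneg (cubicCoords u 2), sq_nonneg (cubicCoords u 1 - 1)]
  have b2 : cubicCoords u 2 ≤ 1 := by nlinarith [sq_nonneg (cubicCoords u 0), sq_nonneg (cubicCoords u 1), sq_nonneg (cubicCoords u 2 - 1)]
  have b0' : -1 ≤ cubicCoords u 0 := by nlinarith [sq_nonneg (cubicCoords u 1), sq_nonneg (cubicCoords u 2), sq_nonneg (cubicCoords u 0 + 1)]
  refine ⟨h.1, fun k hk => ?_⟩
  have hx : k ∈ hexSix ∨ k = 1 ∨ k = 5 ∨ k = 11 := by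
    simp only [lowerNine, mem_insert, mem_singleton] at hk
    rcases hk with rfl | rfl | rfl | rfl | rfl | rfl | rfl | rfl | rfl <;> simp [hexSix]
  rcases hx with hk' | rfl | rfl | rfl
  · exact h.2 k hk'
  all_goals
    rw [inner_slotSite_right, div_le_iff₀ hs]
    simp only [slotInt, Matrix.cons_val_zero, Matrix.cons_val_one, Matrix.cons_val]
    norm_num
    nlinarith

/-- Inner products with opposite hexagon slots. -/
theorem inner_slotSite_opposite (u : EuclideanSpace ℝ (Fin 3)) :
    ⟪u, slotSite 3⟫_ℝ = -⟪u, slotSite 0⟫_ℝ ∧ ⟪u, slotSite 7⟫_ℝ = -⟪u, slotSite 4⟫_ℝ ∧ ⟪u, slotSite 10⟫_ℝ = -⟪u, slotSite 9⟫_ℝ ∧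
    ⟪u, slotSite 0⟫_ℝ = -⟪u, slotSite 3⟫_ℝ ∧ ⟪u, slotSite 4⟫_ℝ = -⟪u, slotSite 7⟫_ℝ ∧ ⟪u, slotSite 9⟫_ℝ = -⟪u, slotSite 10⟫_ℝ := by
  simp only [inner_slotSite_right, slotInt, Matrix.cons_val_zero, Matrix.cons_val_one, Matrix.cons_val]
  norm_num
  refine ⟨by ring, by ring, by ring, by ring, by ring, by ring⟩

/-- The hexagon is centrally symmetric: `HexFree (−u)` from `HexFree u`. -/
theorem HexFree.neg {u : EuclideanSpace ℝ (Fin 3)} (h : HexFree u) : HexFree (-u) := by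
  obtain ⟨o3, o7, o10, o0, o4, o9⟩ := inner_slotSite_opposite u
  refine ⟨by rw [norm_neg, h.1], fun k hk => ?_⟩
  rw [inner_neg_left]
  have m0 := h.2 0 (by decide); have m3 := h.2 3 (by decide); have m4 := h.2 4 (by decide)
  have m7 := h.2 7 (by decide); have m9 := h.2 9 (by decide); have m10 := h.2 10 (by decide)
  simp only [hexSix, mem_insert, mem_singleton] at hk
  rcases hk with rfl | rfl | rfl | rfl | rfl | rfl <;> linarith

/-- Cubic coordinates are linear: negation. -/
theorem cubicCoords_neg_apply (u : EuclideanSpace ℝ (Fin 3)) (i : Fin 3) : cubicCoords (-u) i = -cubicCoords u i := by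
  fin_cases i <;> simp [cubicCoords] <;> ring

/-! ### Packing form -/

/-- A further contact of a ball whose six hexagon positions are occupied gives a hexagon-free direction. -/
theorem hexFree_of_contact {X : Finset (EuclideanSpace ℝ (Fin 3))} (hX : ∀ p ∈ X, ∀ q ∈ X, p ≠ q → 1 ≤ dist p q)
    (L : EuclideanSpace ℝ (Fin 3) ≃ₗᵢ[ℝ] EuclideanSpace ℝ (Fin 3)) {y x : EuclideanSpace ℝ (Fin 3)}
    (hocc : ∀ k ∈ hexSix, y + L (slotSite k) ∈ X) (hx : x ∈ X) (hd : dist y x = 1)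
    (hne : ∀ k ∈ hexSix, x ≠ y + L (slotSite k)) : HexFree (L.symm (x - y)) := by
  have hxy : ‖x - y‖ = 1 := by rw [← dist_eq_norm, dist_comm]; exact hd
  refine ⟨by rw [LinearIsometryEquiv.norm_map]; exact hxy, fun k hk => ?_⟩
  have h1 : ⟪L.symm (x - y), slotSite k⟫_ℝ = ⟪x - y, L (slotSite k)⟫_ℝ := by
    rw [← L.inner_map_map (L.symm (x - y)) (slotSite k), LinearIsometryEquiv.apply_symm_apply]
  rw [h1]
  refine inner_le_half_of_norm_sub_ge_one hxy (by rw [LinearIsometryEquiv.norm_map]; exact norm_eq_one_of_mem_fccSlots (slotSite_mem k)) ?_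
  have : x - y - L (slotSite k) = x - (y + L (slotSite k)) := by abel
  rw [this, ← dist_eq_norm]
  exact hX x hx _ (hocc k hk) (hne k hk)

open scoped Classical in
/-- **Cap-table row «hexagon only»**: in a `1`-separated configuration, a ball `y` whose six hexagon positions `y + L(slotSite k)`, `k ∈ hexSix`, are
occupied has AT MOST FOUR contacts that are neither one of those six balls nor at one of the twelve tip positions (`y + L t`, `y − L t`, `t ∈ healTips`:
the upper and lower fcc and hcp cappers). -/
theorem card_offTip_contacts_le_four_of_hexagon {X : Finset (EuclideanSpace ℝ (Fin 3))} (hX : ∀ p ∈ X, ∀ q ∈ X, p ≠ q → 1 ≤ dist p q)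
    (L : EuclideanSpace ℝ (Fin 3) ≃ₗᵢ[ℝ] EuclideanSpace ℝ (Fin 3)) {y : EuclideanSpace ℝ (Fin 3)}
    (hocc : ∀ k ∈ hexSix, y + L (slotSite k) ∈ X) :
    (X.filter fun x => dist y x = 1 ∧ (∀ k ∈ hexSix, x ≠ y + L (slotSite k)) ∧
      L.symm (x - y) ∉ healTips ∧ -L.symm (x - y) ∉ healTips).card ≤ 4 := by
  set s := X.filter fun x => dist y x = 1 ∧ (∀ k ∈ hexSix, x ≠ y + L (slotSite k)) ∧
      L.symm (x - y) ∉ healTips ∧ -L.symm (x - y) ∉ healTips with hs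
  by_contra hlt
  push Not at hlt
  -- pairwise inner products of contact directions
  have hin : ∀ {p q : EuclideanSpace ℝ (Fin 3)}, p ∈ X → q ∈ X → p ≠ q → dist y p = 1 → dist y q = 1 →
      ⟪L.symm (p - y), L.symm (q - y)⟫_ℝ ≤ 1 / 2 := by
    intro p q hp hq hpq hdp hdq
    rw [L.symm.inner_map_map]
    refine inner_le_half_of_norm_sub_ge_one (by rw [← dist_eq_norm, dist_comm]; exact hdp)
      (by rw [← dist_eq_norm, dist_comm]; exact hdq) ?_
    have : p - y - (q - y) = p - q := by abel
    rw [this, ← dist_eq_norm]; exact hX p hp q hq hpq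
  -- split by hemisphere
  let up : EuclideanSpace ℝ (Fin 3) → Prop := fun x =>
    2 * (Real.sqrt 2 / 2) ≤ -cubicCoords (L.symm (x - y)) 0 + cubicCoords (L.symm (x - y)) 1 + cubicCoords (L.symm (x - y)) 2
  have hsplit := Finset.card_filter_add_card_filter_not (s := s) up
  rcases le_or_gt 3 (s.filter up).card with hU | hU
  · -- three upper contacts: all heal-free, hence tips
    obtain ⟨a, ha, b, hb, c, hc, hab, hac, hbc⟩ := two_lt_card.1 (by omega : 2 < (s.filter up).card)
    rw [mem_filter] at ha hb hc
    rw [hs, mem_filter] at ha hb hc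
    obtain ⟨⟨haX, hda, hnea, hta, -⟩, hua⟩ := ha
    obtain ⟨⟨hbX, hdb, hneb, -, -⟩, hub⟩ := hb
    obtain ⟨⟨hcX, hdc, hnec, -, -⟩, huc⟩ := hc
    have fa := (hexFree_of_contact hX L hocc haX hda hnea).healFree_of_upper hua
    have fb := (hexFree_of_contact hX L hocc hbX hdb hneb).healFree_of_upper hub
    have fc := (hexFree_of_contact hX L hocc hcX hdc hnec).healFree_of_upper huc
    obtain ⟨hta', -, -⟩ := healFree_three fa fb fc (hin haX hbX hab hda hdb) (hin haX hcX hac hda hdc) (hin hbX hcX hbc hdb hdc)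
    exact hta hta'
  · -- three lower contacts: their negatives are heal-free, hence tips
    have hL : 2 < (s.filter fun x => ¬ up x).card := by omega
    obtain ⟨a, ha, b, hb, c, hc, hab, hac, hbc⟩ := two_lt_card.1 hL
    rw [mem_filter] at ha hb hc
    rw [hs, mem_filter] at ha hb hc
    obtain ⟨⟨haX, hda, hnea, -, hta⟩, hua⟩ := ha
    obtain ⟨⟨hbX, hdb, hneb, -, -⟩, hub⟩ := hb
    obtain ⟨⟨hcX, hdc, hnec, -, -⟩, huc⟩ := hc
    have ga := hexFree_of_contact hX L hocc haX hda hnea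
    have gb := hexFree_of_contact hX L hocc hbX hdb hneb
    have gc := hexFree_of_contact hX L hocc hcX hdc hnec
    have low : ∀ {v : EuclideanSpace ℝ (Fin 3)}, HexFree v →
        ¬ 2 * (Real.sqrt 2 / 2) ≤ -cubicCoords v 0 + cubicCoords v 1 + cubicCoords v 2 →
        2 * (Real.sqrt 2 / 2) ≤ -cubicCoords (-v) 0 + cubicCoords (-v) 1 + cubicCoords (-v) 2 := by
      intro v hv hnot
      simp only [cubicCoords_neg_apply]
      rcases hv.axis_cases with h | h
      · exact absurd h hnot
      · linarith
    have fa := ga.neg.healFree_of_upper (low ga hua)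
    have fb := gb.neg.healFree_of_upper (low gb hub)
    have fc := gc.neg.healFree_of_upper (low gc huc)
    have nin : ∀ {p q : EuclideanSpace ℝ (Fin 3)}, ⟪L.symm (p - y), L.symm (q - y)⟫_ℝ ≤ 1 / 2 →
        ⟪-L.symm (p - y), -L.symm (q - y)⟫_ℝ ≤ 1 / 2 := by
      intro p q h; rwa [inner_neg_left, inner_neg_right, neg_neg]
    obtain ⟨hta', -, -⟩ := healFree_three fa fb fc (nin (hin haX hbX hab hda hdb)) (nin (hin haX hcX hac hda hdc))
      (nin (hin hbX hcX hbc hdb hdc))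
    exact hta hta'

end TailResidue

end Summit.Ventures.Crystal3D.Theorems

end
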